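import Literature.NumberTheory.GaloisRepresentations.CubicResidueSymbol
import HarnessLib

/-!
# Cubic residue indices at an inert prime of `ℤ[ρ]`, and two lemmas of Cassels' second `3`-descent

Topic `NumberTheory/GaloisRepresentations` (next to `CubicResidueSymbol.lean`); namespace
`Literature.NumberTheory.GaloisRepresentations.EisensteinCubic`. Everything PROVED (no named facts).

Let `K = ℚ(ρ)` (`IsCyclotomicExtension {3} ℚ K`), `𝓞 K = ℤ[ρ]` a PID (Mathlib `three_pid`), and let
`q ≡ 8 (mod 9)` be a rational prime. Then (`§ Inert`) `q` is inert in `K`: `(q)` is a prime of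
`𝓞 K` with `N(q) = q²` (Mathlib's cyclotomic splitting law `inertiaDeg_eq_of_not_dvd`:
`f = ord₃(q) = 2`). For `s ∈ 𝓞 K ∖ 0` write `s = q^{ord_q s} · up(s)` with `q ∤ up(s)` (`unitPart`)
and put

  `ψ(s) := ind_q(up(s)) ∈ ℤ/3`,  where `χ_q(a) = ρ^{ind_q(a)}` is the cubic residue symbol of the
  tree (`cubicResidueSymbol`, Ireland–Rosen Ch. 9 §3) at the place `(q)` (`§ Index`, `§ Psi`).

`ψ` is additive and kills: `q`, cubes, the units `±ρ^k` of `ℤ[ρ]` (Mathlib `Units.mem`; `18 ∣ q² − 1`),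
`τ = ρ − ρ²` and `λ = 1 − ρ` (`τ² = −3`), and every rational integer prime to `q`
(`(q − 1) ∣ (q² − 1)/3`). These are exactly the evaluations behind the two "local considerations"
of Cassels' proof that `Ш` can be arbitrarily large (J. W. S. Cassels, *Arithmetic on curves of genus
1. VI*, J. reine angew. Math. 214/215 (1964) 65–70, pp. 66–68, for the curve `x³ + y³ + dz³ = 0` over
`ℚ(ρ)` with `q ‖ d`, building on *I*, ibid. 202 (1959) 52–99, §§4–7), in the form used by the tree's
proof of `Cassels1964_sha_threeRank_jZero`:

* `psi_eq_zero_of_dvd_multiplicity` (**the `q`-adic cube criterion**): if `s ∈ 𝓞 K ∖ 0` has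
  `3 ∣ ord_𝔭(s)` at every prime `𝔭 ∤ 3N` of `𝓞 K`, where every prime factor of `N` is `≡ 2 (mod 3)`
  and `q ∣ N`, then `ψ(s) = 0` — because `ℤ[ρ]` is a PID, so `s = ζ · g³ · λ^a · ∏_{p ∣ N} p^{b_p}`;
  this replaces, for second arguments `q ≡ 8 (mod 9)`, the product formula for the cubic norm-residue
  symbols `(·, q)_𝔭` of [I] §10 / Appendix B that Cassels quotes ([VI] p. 67, (11));
* `psi_x_add_psi_u_add_psi_v` (**[VI] p. 66–67 / [I] Lemma 0, 6, 7 at `q`**): for a point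
  `(x, y, z) ∈ (𝓞 K)³` of `x³ + y³ + dz³ = 0` with `xyz ≠ 0`, `q ‖ d`, and `3 ∣ ord_q(u) − ord_q(v)`
  for `u = ρx + ρ²y`, `v = ρ²x + ρy` (i.e. `q³ ∣`-adically `m(𝔵) = u/v` is a cube up to units, as it
  is when `m(𝔵) ≡ m` with `q ∤ m`), one has `ψ(x) + ψ(u) + ψ(v) = 0`: indeed `ord_q x = ord_q y`,
  `x + y ≡ 0`, `u ≡ τx`, `v ≡ −τx (mod q)` after removing `q^{ord_q x}`.

## References

* J. W. S. Cassels, *Arithmetic on curves of genus 1. VI. The Tate–Šafarevič group can be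
  arbitrarily large*, J. reine angew. Math. 214/215 (1964), 65–70, pp. 66–68. [Cassels1964ArithmeticVI]
* J. W. S. Cassels, *Arithmetic on curves of genus 1. I. On a conjecture of Selmer*, J. reine angew.
  Math. 202 (1959), 52–99, §4 Lemma 0, §7 Lemma 6–7, §10, Appendix B. [Cassels1959ArithmeticI]
* K. Ireland, M. Rosen, *A Classical Introduction to Modern Number Theory*, GTM 84 (1982), Ch. 9 §1
  (`ℤ[ω]`, its units and primes; Prop. 9.1.4: rational primes `≡ 2 (mod 3)` are inert), §3 (cubic
  residue character). [IrelandRosen1982]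
-/

noncomputable section

open scoped NumberField

open NumberField IsDedekindDomain Ideal

namespace Literature.NumberTheory.GaloisRepresentations

namespace EisensteinCubic

variable {K : Type*} [Field K] [NumberField K]

/-! ## Inert primes `q ≡ 2 (mod 3)` of `ℚ(ρ)` -/

section Inert

variable [IsCyclotomicExtension {3} ℚ K]

/-- `[𝓞 K : ℤ] = [ℚ(ρ) : ℚ] = φ(3) = 2`. [folklore] -/
theorem finrank_int_ringOfIntegers : Module.finrank ℤ (𝓞 K) = 2 := by
  rw [RingOfIntegers.rank, IsCyclotomicExtension.Rat.finrank (k := 3) K]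
  rfl

/-- `N((p)) = p²` for the principal ideal of a natural number `p` in `𝓞 K`. [folklore] -/
theorem absNorm_span_natCast' (p : ℕ) : absNorm (span {(p : 𝓞 K)}) = p ^ 2 := by
  rw [absNorm_span_natCast, finrank_int_ringOfIntegers]

/-- `ord₃(p) = 2` for `p ≡ 2 (mod 3)`: the class of `p` in `(ℤ/3)` has order `2`. [folklore] -/
theorem orderOf_cast_zmod_three {p : ℕ} (hp3 : p % 3 = 2) : orderOf (p : ZMod 3) = 2 := by
  have h : (p : ZMod 3) = 2 := by
    rw [← ZMod.natCast_mod p 3, hp3]; rfl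
  rw [h]
  exact orderOf_eq_prime (by decide) (by decide)

/-- **Rational primes `p ≡ 2 (mod 3)` are inert in `ℚ(ρ)`** (Ireland–Rosen Prop. 9.1.4 (b)): every
prime `P` of `𝓞 K` above `p` equals `(p)`. Proof: Mathlib's splitting law for cyclotomic fields gives
`f(P|p) = ord₃ p = 2`, so `N(P) = p² = N((p))`, and `(p) ⊆ P`.
[cite: IrelandRosen1982, Ch. 9 §1 Prop. 9.1.4] -/
theorem span_natCast_eq_of_liesOver {p : ℕ} (hp : p.Prime) (hp3 : p % 3 = 2) (P : Ideal (𝓞 K))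
    [P.IsPrime] [hP : P.LiesOver (span {(p : ℤ)})] : span {(p : 𝓞 K)} = P := by
  haveI : Fact p.Prime := ⟨hp⟩
  have hp3' : ¬ p ∣ 3 := by
    intro h
    have := (Nat.prime_dvd_prime_iff_eq hp Nat.prime_three).mp h
    subst this; norm_num at hp3
  have hf : P.inertiaDeg ℤ = 2 := by
    rw [IsCyclotomicExtension.Rat.inertiaDeg_eq_of_not_dvd (m := 3) p K P hp3',
      orderOf_cast_zmod_three hp3]
  have hNP : absNorm P = p ^ 2 := by rw [← Ideal.pow_inertiaDeg p P, hf]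
  have hle : span {(p : 𝓞 K)} ≤ P := by
    rw [span_le, Set.singleton_subset_iff, SetLike.mem_coe]
    have : (algebraMap ℤ (𝓞 K)) (p : ℤ) ∈ P := by
      rw [← Ideal.mem_comap, ← Ideal.under_def, ← hP.over]
      exact Ideal.mem_span_singleton_self _
    simpa using this
  -- `P ∣ (p)`, and the quotient has norm `1`
  obtain ⟨J, hJ⟩ := Ideal.dvd_iff_le.mpr hle
  have hnorm := congrArg absNorm hJ
  rw [absNorm_span_natCast', map_mul, hNP] at hnorm
  have hJ1 : absNorm J = 1 := by
    have hp0 : p ^ 2 ≠ 0 := pow_ne_zero _ hp.ne_zero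
    have : p ^ 2 * absNorm J = p ^ 2 * 1 := by rw [mul_one]; exact hnorm.symm
    exact Nat.eq_of_mul_eq_mul_left (Nat.pos_of_ne_zero hp0) this
  rw [absNorm_eq_one_iff] at hJ1
  rw [hJ, hJ1, Ideal.mul_top]

/-- For `p ≡ 2 (mod 3)` prime, `(p)` is a prime ideal of `𝓞 K`.
[cite: IrelandRosen1982, Ch. 9 §1 Prop. 9.1.4] -/
theorem isPrime_span_natCast {p : ℕ} (hp : p.Prime) (hp3 : p % 3 = 2) :
    (span {(p : 𝓞 K)}).IsPrime := by
  haveI : (span {(p : ℤ)}).IsMaximal :=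
    Ideal.IsPrime.isMaximal (Ideal.span_singleton_prime (by exact_mod_cast hp.ne_zero) |>.mpr
      (Nat.prime_iff_prime_int.mp hp)) (by simpa using hp.ne_zero)
  obtain ⟨⟨P, hPp, hPo⟩⟩ := (span {(p : ℤ)}).nonempty_primesOver (S := 𝓞 K)
  rw [span_natCast_eq_of_liesOver hp hp3 P]
  exact hPp

/-- For `p ≡ 2 (mod 3)` prime, `p` is a prime element of `𝓞 K = ℤ[ρ]`.
[cite: IrelandRosen1982, Ch. 9 §1 Prop. 9.1.4] -/
theorem prime_natCast {p : ℕ} (hp : p.Prime) (hp3 : p % 3 = 2) : Prime (p : 𝓞 K) :=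
  (Ideal.span_singleton_prime (by exact_mod_cast hp.ne_zero)).mp (isPrime_span_natCast hp hp3)

/-- **The inert place `(p)` of `ℚ(ρ)`** for a prime `p ≡ 2 (mod 3)`.
[cite: IrelandRosen1982, Ch. 9 §1 Prop. 9.1.4] -/
def inertPlace {p : ℕ} (hp : p.Prime) (hp3 : p % 3 = 2) : HeightOneSpectrum (𝓞 K) :=
  ⟨span {(p : 𝓞 K)}, isPrime_span_natCast hp hp3, by
    rw [Ne, Ideal.span_singleton_eq_bot]; exact_mod_cast hp.ne_zero⟩

/-- The ideal of the inert place is `(p)`. [folklore] -/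
@[simp] theorem inertPlace_asIdeal {p : ℕ} (hp : p.Prime) (hp3 : p % 3 = 2) :
    (inertPlace (K := K) hp hp3).asIdeal = span {(p : 𝓞 K)} := rfl

/-- `N((p)) = p²`: the residue field of the inert place has `p²` elements.
[cite: IrelandRosen1982, Ch. 9 §1 Prop. 9.1.4] -/
theorem residueCard_inertPlace {p : ℕ} (hp : p.Prime) (hp3 : p % 3 = 2) :
    (inertPlace (K := K) hp hp3).residueCard = p ^ 2 := by
  rw [HeightOneSpectrum.residueCard, inertPlace_asIdeal, absNorm_span_natCast']

/-- Membership in `(p)`: `s ∈ (p) ↔ p ∣ s`. [folklore] -/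
theorem mem_inertPlace_iff {p : ℕ} (hp : p.Prime) (hp3 : p % 3 = 2) {s : 𝓞 K} :
    s ∈ (inertPlace (K := K) hp hp3).asIdeal ↔ (p : 𝓞 K) ∣ s := by
  rw [inertPlace_asIdeal, Ideal.mem_span_singleton]

/-- `3 ∉ (p)` for `p ≡ 2 (mod 3)`. [folklore] -/
theorem three_not_mem_inertPlace {p : ℕ} (hp : p.Prime) (hp3 : p % 3 = 2) :
    (3 : 𝓞 K) ∉ (inertPlace (K := K) hp hp3).asIdeal := by
  rw [mem_inertPlace_iff]
  intro h
  have h3 : (p : 𝓞 K) ∣ ((3 : ℕ) : 𝓞 K) := by simpa using h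
  have hp3' : ¬ p ∣ 3 := by
    intro h'
    have := (Nat.prime_dvd_prime_iff_eq hp Nat.prime_three).mp h'
    subst this; norm_num at hp3
  -- norms: `p² ∣ 9` would follow
  have := Ideal.absNorm_dvd_absNorm_of_le (Ideal.span_singleton_le_span_singleton.mpr h3)
  rw [absNorm_span_natCast', absNorm_span_natCast'] at this
  exact hp3' ((Nat.Prime.dvd_of_dvd_pow hp) ((dvd_pow_self p two_ne_zero).trans this))

/-- A natural number prime to `p` is not in `(p)`. [folklore] -/
theorem natCast_not_mem_inertPlace {p : ℕ} (hp : p.Prime) (hp3 : p % 3 = 2) {a : ℕ}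
    (ha : ¬ p ∣ a) : (a : 𝓞 K) ∉ (inertPlace (K := K) hp hp3).asIdeal := by
  rw [mem_inertPlace_iff]
  intro h
  have := Ideal.absNorm_dvd_absNorm_of_le (Ideal.span_singleton_le_span_singleton.mpr h)
  rw [absNorm_span_natCast', absNorm_span_natCast'] at this
  exact ha ((Nat.Prime.dvd_of_dvd_pow hp) ((dvd_pow_self p two_ne_zero).trans this))

end Inert

/-! ## The cubic index `ind_𝔭 : (𝓞 K ⧸ 𝔭) → ℤ/3`, `χ_𝔭(a) = ζ^{ind_𝔭(a)}` -/

section Index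

variable {ζ : 𝓞 K} (hζ : IsPrimitiveRoot ζ 3) (𝔭 : HeightOneSpectrum (𝓞 K))

include hζ in
omit [NumberField K] in
/-- The powers `ζ^{c.val}`, `c ∈ ℤ/3`, are pairwise distinct. [folklore] -/
theorem zeta_pow_val_injective : Function.Injective fun c : ZMod 3 => ζ ^ c.val := by
  intro c c' h
  have := hζ.pow_inj (ZMod.val_lt c) (ZMod.val_lt c') h
  exact ZMod.val_injective 3 this

include hζ in
omit [NumberField K] in
/-- `ζ^{(c + c').val} = ζ^{c.val} ζ^{c'.val}`. [folklore] -/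
theorem zeta_pow_val_add (c c' : ZMod 3) : ζ ^ (c + c').val = ζ ^ c.val * ζ ^ c'.val := by
  rw [← pow_add, ZMod.val_add]
  conv_rhs => rw [← Nat.mod_add_div (c.val + c'.val) 3, pow_add, pow_mul, hζ.pow_eq_one, one_pow,
    mul_one]

include hζ in
/-- For `𝔭 ∤ 3` and `a ≠ 0` there is a unique `c ∈ ℤ/3` with `χ_𝔭(a) = ζ^c` (Ireland–Rosen Prop. 9.3.2).
[cite: IrelandRosen1982, Ch. 9 §3, Prop. 9.3.2] -/
theorem existsUnique_cubicResidueSymbol_eq_pow (h3 : (3 : 𝓞 K) ∉ 𝔭.asIdeal)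
    {a : 𝓞 K ⧸ 𝔭.asIdeal} (ha : a ≠ 0) : ∃! c : ZMod 3, cubicResidueSymbol 𝔭 a = ζ ^ c.val := by
  obtain ⟨h1, -⟩ := cubicResidueSymbol_spec hζ h3 ha
  obtain ⟨i, hi, heq⟩ := hζ.eq_pow_of_pow_eq_one h1
  refine ⟨(i : ZMod 3), ?_, fun c hc => ?_⟩
  · change cubicResidueSymbol 𝔭 a = ζ ^ (i : ZMod 3).val
    rw [ZMod.val_natCast, Nat.mod_eq_of_lt hi, heq]
  · apply zeta_pow_val_injective hζ
    change ζ ^ c.val = ζ ^ (i : ZMod 3).val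
    rw [ZMod.val_natCast, Nat.mod_eq_of_lt hi, heq, hc]

/-- **The cubic index** `ind_𝔭(a) ∈ ℤ/3`: the exponent with `χ_𝔭(a) = ζ^{ind_𝔭(a)}` (for `𝔭 ∤ 3`,
`a ≠ 0`; junk `0` otherwise). [cite: IrelandRosen1982, Ch. 9 §3, Definition after Prop. 9.3.2] -/
def cubicIndex (a : 𝓞 K ⧸ 𝔭.asIdeal) : ZMod 3 :=
  haveI := Classical.dec
  if h : ∃ c : ZMod 3, cubicResidueSymbol 𝔭 a = ζ ^ c.val then h.choose else 0

include hζ in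
/-- Defining property: `χ_𝔭(a) = ζ^{ind_𝔭(a)}` for `𝔭 ∤ 3`, `a ≠ 0`.
[cite: IrelandRosen1982, Ch. 9 §3, Prop. 9.3.2] -/
theorem pow_cubicIndex (h3 : (3 : 𝓞 K) ∉ 𝔭.asIdeal) {a : 𝓞 K ⧸ 𝔭.asIdeal} (ha : a ≠ 0) :
    ζ ^ (cubicIndex (ζ := ζ) 𝔭 a).val = cubicResidueSymbol 𝔭 a := by
  have hex := (existsUnique_cubicResidueSymbol_eq_pow hζ 𝔭 h3 ha).exists
  unfold cubicIndex
  rw [dif_pos hex]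
  exact hex.choose_spec.symm

include hζ in
/-- Characterisation: `ind_𝔭(a) = c ↔ ζ^c ≡ a^{(N𝔭−1)/3} (mod 𝔭)`.
[cite: IrelandRosen1982, Ch. 9 §3, Prop. 9.3.2] -/
theorem cubicIndex_eq_iff (h3 : (3 : 𝓞 K) ∉ 𝔭.asIdeal) {a : 𝓞 K ⧸ 𝔭.asIdeal} (ha : a ≠ 0)
    {c : ZMod 3} :
    cubicIndex (ζ := ζ) 𝔭 a = c ↔
      Ideal.Quotient.mk 𝔭.asIdeal (ζ ^ c.val) = a ^ ((𝔭.residueCard - 1) / 3) := by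
  constructor
  · rintro rfl
    rw [pow_cubicIndex hζ 𝔭 h3 ha]
    exact (cubicResidueSymbol_spec hζ h3 ha).2
  · intro h
    have h1 : (ζ ^ c.val) ^ 3 = 1 := by
      rw [← pow_mul, mul_comm, pow_mul, hζ.pow_eq_one, one_pow]
    have := cubicResidueSymbol_eq_of_pow_three_eq_one hζ h3 h1 h
    apply zeta_pow_val_injective hζ
    change ζ ^ (cubicIndex 𝔭 a).val = ζ ^ c.val
    rw [pow_cubicIndex hζ 𝔭 h3 ha, this]

include hζ in
/-- **Multiplicativity** `ind_𝔭(ab) = ind_𝔭(a) + ind_𝔭(b)` (`a, b ≠ 0`; Ireland–Rosen Prop. 9.3.3 (c)).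
[cite: IrelandRosen1982, Ch. 9 §3, Prop. 9.3.3 (c)] -/
theorem cubicIndex_mul (h3 : (3 : 𝓞 K) ∉ 𝔭.asIdeal) {a b : 𝓞 K ⧸ 𝔭.asIdeal} (ha : a ≠ 0)
    (hb : b ≠ 0) :
    cubicIndex (ζ := ζ) 𝔭 (a * b) = cubicIndex (ζ := ζ) 𝔭 a + cubicIndex (ζ := ζ) 𝔭 b := by
  letI := Ideal.Quotient.field 𝔭.asIdeal
  rw [cubicIndex_eq_iff hζ 𝔭 h3 (mul_ne_zero ha hb), zeta_pow_val_add hζ, map_mul, mul_pow,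
    ← (cubicIndex_eq_iff hζ 𝔭 h3 ha).mp rfl, ← (cubicIndex_eq_iff hζ 𝔭 h3 hb).mp rfl]

include hζ in
/-- `ind_𝔭(a) = 0` as soon as `a^m = 1` for some `m ∣ (N𝔭 − 1)/3`. [folklore] -/
theorem cubicIndex_eq_zero_of_pow_eq_one (h3 : (3 : 𝓞 K) ∉ 𝔭.asIdeal) {a : 𝓞 K ⧸ 𝔭.asIdeal}
    {m : ℕ} (hm : m ∣ (𝔭.residueCard - 1) / 3) (h : a ^ m = 1) : cubicIndex (ζ := ζ) 𝔭 a = 0 := by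
  have ha : a ≠ 0 := by
    rintro rfl
    rcases Nat.eq_zero_or_pos m with rfl | hm0
    · rw [zero_dvd_iff] at hm
      exact residueCard_sub_one_div_three_ne_zero hζ h3 hm
    · rw [zero_pow hm0.ne'] at h
      exact zero_ne_one h
  rw [cubicIndex_eq_iff hζ 𝔭 h3 ha, ZMod.val_zero, pow_zero, map_one]
  obtain ⟨k, hk⟩ := hm
  rw [hk, pow_mul, h, one_pow]

include hζ in
/-- Cubes have index `0`. [folklore] -/
theorem cubicIndex_pow_three (h3 : (3 : 𝓞 K) ∉ 𝔭.asIdeal) {a : 𝓞 K ⧸ 𝔭.asIdeal} (ha : a ≠ 0) :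
    cubicIndex (ζ := ζ) 𝔭 (a ^ 3) = 0 := by
  rw [pow_succ, pow_two, cubicIndex_mul hζ 𝔭 h3 (mul_ne_zero ha ha) ha, cubicIndex_mul hζ 𝔭 h3 ha ha]
  generalize cubicIndex (ζ := ζ) 𝔭 a = c
  have : c + c + c = 3 * c := by ring
  rw [this, show (3 : ZMod 3) = 0 from rfl, zero_mul]

include hζ in
/-- `ind_𝔭(1) = 0`. [folklore] -/
theorem cubicIndex_one (h3 : (3 : 𝓞 K) ∉ 𝔭.asIdeal) : cubicIndex (ζ := ζ) 𝔭 1 = 0 :=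
  cubicIndex_eq_zero_of_pow_eq_one hζ 𝔭 h3 (m := 1) (one_dvd _) (one_pow 1)

include hζ in
/-- `ind_𝔭(−1) = 0` (`−1 = (−1)³`). [folklore] -/
theorem cubicIndex_neg_one (h3 : (3 : 𝓞 K) ∉ 𝔭.asIdeal) : cubicIndex (ζ := ζ) 𝔭 (-1) = 0 := by
  letI := Ideal.Quotient.field 𝔭.asIdeal
  have : ((-1 : 𝓞 K ⧸ 𝔭.asIdeal)) = (-1) ^ 3 := by norm_num
  rw [this]
  exact cubicIndex_pow_three hζ 𝔭 h3 (neg_ne_zero.mpr one_ne_zero)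

end Index

/-! ## The unit part at a principal prime `(π)` and the character `ψ` -/

section UnitPart

variable {π : 𝓞 K} (hπ : Prime π)

include hπ in
/-- `ord_π(s) = multiplicity π s` is finite for `s ≠ 0`. [folklore] -/
theorem finiteMultiplicity_of_ne_zero {s : 𝓞 K} (hs : s ≠ 0) : FiniteMultiplicity π s :=
  FiniteMultiplicity.of_prime_left hπ hs

variable (π) in
/-- **The unit part** `up_π(s)`: `s = π^{ord_π s} · up_π(s)` with `π ∤ up_π(s)` (for `s ≠ 0`;
`up_π(0) = 0`). [folklore] -/
def unitPart (s : 𝓞 K) : 𝓞 K := (pow_multiplicity_dvd π s).choose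

omit [NumberField K] in
/-- `s = π^{ord_π s} · up_π(s)`. [folklore] -/
theorem pow_mul_unitPart (s : 𝓞 K) : π ^ multiplicity π s * unitPart π s = s :=
  (pow_multiplicity_dvd π s).choose_spec.symm

include hπ in
/-- `π ∤ up_π(s)` for `s ≠ 0`. [folklore] -/
theorem not_dvd_unitPart {s : 𝓞 K} (hs : s ≠ 0) : ¬ π ∣ unitPart π s := by
  obtain ⟨c, hc, hndvd⟩ := (finiteMultiplicity_of_ne_zero hπ hs).exists_eq_pow_mul_and_not_dvd
  have h := pow_mul_unitPart (π := π) s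
  have : unitPart π s = c := mul_left_cancel₀ (pow_ne_zero _ hπ.ne_zero) (h.trans hc)
  rwa [this]

include hπ in
/-- `up_π(s) ≠ 0` for `s ≠ 0`. [folklore] -/
theorem unitPart_ne_zero {s : 𝓞 K} (hs : s ≠ 0) : unitPart π s ≠ 0 := fun h =>
  not_dvd_unitPart hπ hs (h ▸ dvd_zero π)

include hπ in
/-- Uniqueness of the decomposition: if `s = πⁿ c` with `π ∤ c` then `n = ord_π s` and
`c = up_π(s)`. [folklore] -/
theorem unitPart_eq_of_eq_pow_mul {s c : 𝓞 K} {n : ℕ} (hs : s ≠ 0) (h : s = π ^ n * c)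
    (hc : ¬ π ∣ c) : multiplicity π s = n ∧ unitPart π s = c := by
  have hfin := finiteMultiplicity_of_ne_zero hπ hs
  have hn : multiplicity π s = n := by
    refine (hfin.multiplicity_eq_iff).mpr ⟨⟨c, h⟩, fun ⟨e, he⟩ => hc ?_⟩
    rw [h, pow_succ, mul_assoc] at he
    exact ⟨e, mul_left_cancel₀ (pow_ne_zero _ hπ.ne_zero) he⟩
  refine ⟨hn, ?_⟩
  have h' := pow_mul_unitPart (π := π) s
  rw [hn] at h'
  exact mul_left_cancel₀ (pow_ne_zero _ hπ.ne_zero) (h'.trans h)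

include hπ in
/-- `up_π(st) = up_π(s) up_π(t)` and `ord_π(st) = ord_π s + ord_π t`. [folklore] -/
theorem unitPart_mul {s t : 𝓞 K} (hs : s ≠ 0) (ht : t ≠ 0) :
    multiplicity π (s * t) = multiplicity π s + multiplicity π t ∧
      unitPart π (s * t) = unitPart π s * unitPart π t := by
  refine unitPart_eq_of_eq_pow_mul hπ (mul_ne_zero hs ht) ?_ ?_
  · conv_lhs => rw [← pow_mul_unitPart (π := π) s, ← pow_mul_unitPart (π := π) t]
    ring
  · intro h
    rcases hπ.dvd_or_dvd h with h | h
    · exact not_dvd_unitPart hπ hs h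
    · exact not_dvd_unitPart hπ ht h

include hπ in
/-- `up_π(π) = 1`, `ord_π(π) = 1`. [folklore] -/
theorem unitPart_self : multiplicity π π = 1 ∧ unitPart π π = 1 :=
  unitPart_eq_of_eq_pow_mul hπ hπ.ne_zero (by rw [pow_one, mul_one])
    (fun h => hπ.not_unit (isUnit_of_dvd_one h))

include hπ in
/-- `up_π(s) = s` when `π ∤ s`. [folklore] -/
theorem unitPart_of_not_dvd {s : 𝓞 K} (hs : ¬ π ∣ s) : multiplicity π s = 0 ∧ unitPart π s = s :=
  unitPart_eq_of_eq_pow_mul hπ (fun h => hs (h ▸ dvd_zero π)) (by rw [pow_zero, one_mul]) hs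

include hπ in
/-- `up_π(s^n) = up_π(s)^n`. [folklore] -/
theorem unitPart_pow {s : 𝓞 K} (hs : s ≠ 0) (n : ℕ) :
    multiplicity π (s ^ n) = n * multiplicity π s ∧ unitPart π (s ^ n) = unitPart π s ^ n := by
  induction n with
  | zero =>
    rw [pow_zero, pow_zero, zero_mul]
    exact unitPart_of_not_dvd hπ (fun h => hπ.not_unit (isUnit_of_dvd_one h))
  | succ n ih =>
    rw [pow_succ, pow_succ]
    obtain ⟨h1, h2⟩ := unitPart_mul hπ (pow_ne_zero n hs) hs
    rw [h1, h2, ih.1, ih.2]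
    exact ⟨by ring, rfl⟩

end UnitPart

section Psi

variable [IsCyclotomicExtension {3} ℚ K] {ζ : 𝓞 K} (hζ : IsPrimitiveRoot ζ 3) {q : ℕ}

/-- `q ≡ 8 (mod 9)` implies `q ≡ 2 (mod 3)`. [folklore] -/
theorem mod_three_of_mod_nine (hq9 : q % 9 = 8) : q % 3 = 2 := by omega

/-- `q − 1 ∣ (q² − 1)/3`, `3 ∣ (q² − 1)/3` and `6 ∣ (q² − 1)/3` for a prime `q ≡ 8 (mod 9)`.
[folklore] -/
theorem dvd_residue_exponent (hq : q.Prime) (hq9 : q % 9 = 8) :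
    (q - 1) ∣ (q ^ 2 - 1) / 3 ∧ 3 ∣ (q ^ 2 - 1) / 3 ∧ 6 ∣ (q ^ 2 - 1) / 3 := by
  have hodd : q % 2 = 1 := by
    rcases hq.eq_two_or_odd with h | h
    · omega
    · exact h
  have hq1 : 1 ≤ q := hq.one_lt.le
  have hsq : q ^ 2 - 1 = (q - 1) * (q + 1) := by
    zify [hq1, Nat.one_le_pow 2 q hq1]
    ring
  -- `q + 1 = 9j`, `q - 1 = 2i`
  obtain ⟨j, hj⟩ : 9 ∣ q + 1 := by omega
  obtain ⟨i, hi⟩ : 2 ∣ q - 1 := by omega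
  have hdiv : (q ^ 2 - 1) / 3 = (q - 1) * (3 * j) := by
    rw [hsq, hj, show (q - 1) * (9 * j) = 3 * ((q - 1) * (3 * j)) by ring,
      Nat.mul_div_cancel_left _ (by norm_num)]
  refine ⟨⟨3 * j, hdiv⟩, ⟨(q - 1) * j, by rw [hdiv]; ring⟩, ⟨i * j, ?_⟩⟩
  rw [hdiv, hi]; ring

variable (ζ q) in
/-- **Cassels' local character at `q`**: `ψ(s) = ind_q(up_q(s))`, the cubic index of the unit part of
`s ∈ 𝓞 K` at the inert prime `(q)` — the exponent `c` in `(s q^{-ord_q s} / q)₃ = ρ^c`, i.e. the value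
of the tame symbol `(s, q)_q` of [VI] (11). [cite: Cassels1964ArithmeticVI, p. 67 (11)] -/
def psi (hq : q.Prime) (hq9 : q % 9 = 8) (s : 𝓞 K) : ZMod 3 :=
  cubicIndex (ζ := ζ) (inertPlace hq (mod_three_of_mod_nine hq9))
    (Ideal.Quotient.mk _ (unitPart (q : 𝓞 K) s))

/-- The prime element `q ∈ 𝓞 K`. [folklore] -/
theorem prime_q (hq : q.Prime) (hq9 : q % 9 = 8) : Prime (q : 𝓞 K) :=
  prime_natCast hq (mod_three_of_mod_nine hq9)

variable (K) in
/-- The inert place `(q)` for a prime `q ≡ 8 (mod 9)` (abbreviation). [folklore] -/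
abbrev qPlace (hq : q.Prime) (hq9 : q % 9 = 8) : HeightOneSpectrum (𝓞 K) :=
  inertPlace hq (mod_three_of_mod_nine hq9)

/-- Unfolding `ψ`. [folklore] -/
theorem psi_def (hq : q.Prime) (hq9 : q % 9 = 8) (s : 𝓞 K) :
    psi ζ q hq hq9 s = cubicIndex (ζ := ζ) (qPlace K hq hq9) (Ideal.Quotient.mk _ (unitPart (q : 𝓞 K) s)) :=
  rfl

/-- `3 ∉ (q)`. [folklore] -/
theorem three_not_mem (hq : q.Prime) (hq9 : q % 9 = 8) : (3 : 𝓞 K) ∉ (qPlace K hq hq9).asIdeal :=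
  three_not_mem_inertPlace hq _

/-- The residue of the unit part of `s ≠ 0` is non-zero. [folklore] -/
theorem mk_unitPart_ne_zero (hq : q.Prime) (hq9 : q % 9 = 8) {s : 𝓞 K} (hs : s ≠ 0) :
    Ideal.Quotient.mk (qPlace K hq hq9).asIdeal (unitPart (q : 𝓞 K) s) ≠ 0 := by
  rw [Ne, Ideal.Quotient.eq_zero_iff_mem, mem_inertPlace_iff]
  exact not_dvd_unitPart (prime_q hq hq9) hs

include hζ in
/-- **`ψ` is additive**: `ψ(st) = ψ(s) + ψ(t)` for `s, t ≠ 0`. [folklore] -/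
theorem psi_mul (hq : q.Prime) (hq9 : q % 9 = 8) {s t : 𝓞 K} (hs : s ≠ 0) (ht : t ≠ 0) :
    psi ζ q hq hq9 (s * t) = psi ζ q hq hq9 s + psi ζ q hq hq9 t := by
  unfold psi
  rw [(unitPart_mul (prime_q hq hq9) hs ht).2, map_mul,
    cubicIndex_mul hζ _ (three_not_mem hq hq9) (mk_unitPart_ne_zero hq hq9 hs)
      (mk_unitPart_ne_zero hq hq9 ht)]

include hζ in
/-- `ψ(1) = 0`. [folklore] -/
theorem psi_one (hq : q.Prime) (hq9 : q % 9 = 8) : psi ζ q hq hq9 1 = 0 := by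
  unfold psi
  rw [(unitPart_of_not_dvd (prime_q hq hq9) (fun h => (prime_q hq hq9).not_unit
    (isUnit_of_dvd_one h))).2, map_one, cubicIndex_one hζ _ (three_not_mem hq hq9)]

include hζ in
/-- `ψ(s^n) = n ψ(s)`. [folklore] -/
theorem psi_pow (hq : q.Prime) (hq9 : q % 9 = 8) {s : 𝓞 K} (hs : s ≠ 0) (n : ℕ) :
    psi ζ q hq hq9 (s ^ n) = n * psi ζ q hq hq9 s := by
  induction n with
  | zero => rw [pow_zero, psi_one hζ hq hq9, Nat.cast_zero, zero_mul]
  | succ n ih => rw [pow_succ, psi_mul hζ hq hq9 (pow_ne_zero n hs) hs, ih]; push_cast; ring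

include hζ in
/-- **Cubes:** `ψ(s³) = 0`. [folklore] -/
theorem psi_pow_three (hq : q.Prime) (hq9 : q % 9 = 8) {s : 𝓞 K} (hs : s ≠ 0) :
    psi ζ q hq hq9 (s ^ 3) = 0 := by
  rw [psi_pow hζ hq hq9 hs, Nat.cast_ofNat, show (3 : ZMod 3) = 0 from rfl, zero_mul]

/-- For `s` prime to `q`, `ψ(s) = ind_q(s)`. [folklore] -/
theorem psi_of_not_dvd (hq : q.Prime) (hq9 : q % 9 = 8) {s : 𝓞 K} (hs : ¬ (q : 𝓞 K) ∣ s) :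
    psi ζ q hq hq9 s = cubicIndex (ζ := ζ) (qPlace K hq hq9) (Ideal.Quotient.mk _ s) := by
  unfold psi
  rw [(unitPart_of_not_dvd (prime_q hq hq9) hs).2]

include hζ in
/-- **`ψ(q) = 0`.** [folklore] -/
theorem psi_q (hq : q.Prime) (hq9 : q % 9 = 8) : psi ζ q hq hq9 q = 0 := by
  unfold psi
  rw [(unitPart_self (prime_q hq hq9)).2, map_one, cubicIndex_one hζ _ (three_not_mem hq hq9)]

include hζ in
/-- `ψ(qⁿ s) = ψ(s)`. [folklore] -/
theorem psi_q_pow_mul (hq : q.Prime) (hq9 : q % 9 = 8) {s : 𝓞 K} (hs : s ≠ 0) (n : ℕ) :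
    psi ζ q hq hq9 ((q : 𝓞 K) ^ n * s) = psi ζ q hq hq9 s := by
  have hq0 : (q : 𝓞 K) ≠ 0 := (prime_q hq hq9).ne_zero
  rw [psi_mul hζ hq hq9 (pow_ne_zero n hq0) hs, psi_pow hζ hq hq9 hq0, psi_q hζ hq hq9, mul_zero,
    zero_add]

include hζ in
/-- `ψ(s) = 0` whenever `s^m ≡ 1 (mod q)` with `m ∣ (q² − 1)/3`. [folklore] -/
theorem psi_eq_zero_of_pow_mem (hq : q.Prime) (hq9 : q % 9 = 8) {s : 𝓞 K} {m : ℕ}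
    (hm : m ∣ (q ^ 2 - 1) / 3) (h : s ^ m - 1 ∈ (qPlace K hq hq9).asIdeal) : psi ζ q hq hq9 s = 0 := by
  have hs : ¬ (q : 𝓞 K) ∣ s := by
    intro hqs
    rcases Nat.eq_zero_or_pos m with rfl | hm0
    · rw [zero_dvd_iff] at hm
      have := residueCard_sub_one_div_three_ne_zero hζ (three_not_mem hq hq9)
      rw [residueCard_inertPlace] at this
      exact this hm
    · have h1 : s ^ m ∈ (qPlace K hq hq9).asIdeal := (mem_inertPlace_iff hq _).mpr (dvd_pow hqs hm0.ne')
      have : (1 : 𝓞 K) ∈ (qPlace K hq hq9).asIdeal := by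
        have := (qPlace K hq hq9).asIdeal.sub_mem h1 h
        rwa [sub_sub_cancel] at this
      exact (qPlace K hq hq9).isPrime.ne_top ((Ideal.eq_top_iff_one _).mpr this)
  rw [psi_of_not_dvd hq hq9 hs]
  refine cubicIndex_eq_zero_of_pow_eq_one hζ _ (three_not_mem hq hq9) (m := m) ?_ ?_
  · rwa [residueCard_inertPlace]
  · rw [← map_pow, ← (Ideal.Quotient.mk _).map_one, Ideal.Quotient.eq]
    exact h

include hζ in
/-- **Integers prime to `q` have `ψ = 0`** (`a^{q−1} ≡ 1 (mod q)`, `q − 1 ∣ (q² − 1)/3`). [folklore] -/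
theorem psi_intCast (hq : q.Prime) (hq9 : q % 9 = 8) {a : ℤ} (ha : ¬ (q : ℤ) ∣ a) :
    psi ζ q hq hq9 a = 0 := by
  refine psi_eq_zero_of_pow_mem hζ hq hq9 (m := q - 1) (dvd_residue_exponent hq hq9).1 ?_
  haveI : Fact q.Prime := ⟨hq⟩
  have hF : (a : ZMod q) ^ (q - 1) = 1 := ZMod.pow_card_sub_one_eq_one (by
    intro h0; exact ha ((ZMod.intCast_zmod_eq_zero_iff_dvd a q).mp h0))
  have hdvd : (q : ℤ) ∣ a ^ (q - 1) - 1 := by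
    rw [← ZMod.intCast_zmod_eq_zero_iff_dvd]; push_cast; rw [hF, sub_self]
  obtain ⟨c, hc⟩ := hdvd
  rw [mem_inertPlace_iff]
  refine ⟨(c : 𝓞 K), ?_⟩
  have h := congrArg (Int.castRingHom (𝓞 K)) hc
  simpa only [map_sub, map_pow, map_mul, map_one, eq_intCast, Int.cast_natCast] using h

include hζ in
/-- Natural numbers prime to `q` have `ψ = 0`. [folklore] -/
theorem psi_natCast (hq : q.Prime) (hq9 : q % 9 = 8) {a : ℕ} (ha : ¬ q ∣ a) :
    psi ζ q hq hq9 a = 0 := by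
  have := psi_intCast hζ hq hq9 (a := a) (fun h => ha (Int.natCast_dvd_natCast.mp h))
  rwa [Int.cast_natCast] at this

include hζ in
/-- `ψ(−1) = 0` (`−1` is a cube). [folklore] -/
theorem psi_neg_one (hq : q.Prime) (hq9 : q % 9 = 8) : psi ζ q hq hq9 (-1) = 0 := by
  have := psi_intCast hζ hq hq9 (a := -1) (fun h => by
    have := Int.eq_one_of_dvd_one (Int.natCast_nonneg q) ((Int.dvd_neg).mp h)
    have h1 := hq.one_lt; omega)
  simpa using this

include hζ in
/-- `ψ(−s) = ψ(s)`. [folklore] -/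
theorem psi_neg (hq : q.Prime) (hq9 : q % 9 = 8) {s : 𝓞 K} (hs : s ≠ 0) :
    psi ζ q hq hq9 (-s) = psi ζ q hq hq9 s := by
  rw [neg_eq_neg_one_mul, psi_mul hζ hq hq9 (neg_ne_zero.mpr one_ne_zero) hs, psi_neg_one hζ hq hq9,
    zero_add]

include hζ in
/-- **`ψ(ζ) = 0`** for `q ≡ 8 (mod 9)`: `ζ^{(q²−1)/3} = 1` since `9 ∣ q² − 1`. [folklore] -/
theorem psi_zeta (hq : q.Prime) (hq9 : q % 9 = 8) : psi ζ q hq hq9 ζ = 0 :=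
  psi_eq_zero_of_pow_mem hζ hq hq9 (m := 3) (dvd_residue_exponent hq hq9).2.1
    (by rw [hζ.pow_eq_one, sub_self]; exact (qPlace K hq hq9).asIdeal.zero_mem)

include hζ in
/-- **`ψ(τ) = 0`** for `τ = ζ − ζ²` (`τ² = −3`). [folklore] -/
theorem psi_tau (hq : q.Prime) (hq9 : q % 9 = 8) : psi ζ q hq hq9 (ζ - ζ ^ 2) = 0 := by
  have hz : ζ ^ 2 + ζ + 1 = 0 := sq_add_self_add_one_eq_zero hζ
  have hτ2 : (ζ - ζ ^ 2) ^ 2 = -3 := by linear_combination (ζ ^ 2 - 3 * ζ + 3) * hz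
  have hτ0 : ζ - ζ ^ 2 ≠ 0 := by
    intro h; rw [h] at hτ2; norm_num at hτ2
  have h3 : psi ζ q hq hq9 (-3) = 0 := by
    have := psi_intCast hζ hq hq9 (a := -3) (fun h => by
      have h' : q ∣ 3 := by exact_mod_cast (Int.dvd_neg).mp h
      rcases (Nat.dvd_prime Nat.prime_three).mp h' with h1 | h1 <;> subst h1 <;> norm_num at hq9)
    simpa using this
  have h2 := psi_pow hζ hq hq9 hτ0 2
  rw [hτ2, h3] at h2
  -- `0 = 2 ψ(τ)` in `ℤ/3`
  have : (2 : ZMod 3) * psi ζ q hq hq9 (ζ - ζ ^ 2) = 0 := by exact_mod_cast h2.symm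
  calc psi ζ q hq hq9 (ζ - ζ ^ 2) = 4 * psi ζ q hq hq9 (ζ - ζ ^ 2) := by
        rw [show (4 : ZMod 3) = 1 from rfl, one_mul]
    _ = 2 * (2 * psi ζ q hq hq9 (ζ - ζ ^ 2)) := by ring
    _ = 0 := by rw [this, mul_zero]

include hζ in
/-- **`ψ(λ) = 0`** for `λ = ζ − 1` (`λ² = −3ζ`). [folklore] -/
theorem psi_lambda (hq : q.Prime) (hq9 : q % 9 = 8) : psi ζ q hq hq9 (ζ - 1) = 0 := by
  have hz : ζ ^ 2 + ζ + 1 = 0 := sq_add_self_add_one_eq_zero hζ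
  -- `ζ - ζ² = ζ (1 - ζ) = -ζ (ζ - 1)`
  have hζ0 : ζ ≠ 0 := hζ.ne_zero (by norm_num)
  have hl0 : ζ - 1 ≠ 0 := sub_ne_zero.mpr (hζ.ne_one (by norm_num))
  have e : ζ - ζ ^ 2 = -(ζ * (ζ - 1)) := by ring
  have := psi_tau hζ hq hq9
  rw [e, psi_neg hζ hq hq9 (mul_ne_zero hζ0 hl0), psi_mul hζ hq hq9 hζ0 hl0, psi_zeta hζ hq hq9,
    zero_add] at this
  exact this

include hζ in
/-- **`ψ(unit) = 0`**: the units of `ℤ[ρ]` are `±ζ^k` (Mathlib `Units.mem`), so `u⁶ = 1`, and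
`6 ∣ (q² − 1)/3`. [cite: IrelandRosen1982, Ch. 9 §1 (units of ℤ[ω])] -/
theorem psi_unit (hq : q.Prime) (hq9 : q % 9 = 8) (u : (𝓞 K)ˣ) : psi ζ q hq hq9 u = 0 := by
  -- transport `hζ` to a primitive root of `K` to use Mathlib's classification of units
  have hζK : IsPrimitiveRoot ((ζ : 𝓞 K) : K) 3 := hζ.map_of_injective RingOfIntegers.coe_injective
  have hto : hζK.toInteger = ζ := Subtype.ext rfl
  have hmem := IsCyclotomicExtension.Rat.Three.Units.mem hζK u
  have h6 : (u : 𝓞 K) ^ 6 = 1 := by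
    have hz3 : ζ ^ 3 = 1 := hζ.pow_eq_one
    simp only [List.mem_cons, List.mem_nil_iff, or_false] at hmem
    rcases hmem with h | h | h | h | h | h <;>
    · rw [h]
      simp only [Units.val_one, Units.val_neg, Units.val_pow_eq_pow_val, IsUnit.unit_spec, hto]
      first
        | linear_combination (ζ ^ 3 + 1) * hz3
        | linear_combination (ζ ^ 9 + ζ ^ 6 + ζ ^ 3 + 1) * hz3
        | norm_num
  exact psi_eq_zero_of_pow_mem hζ hq hq9 (m := 6) (dvd_residue_exponent hq hq9).2.2
    (by rw [h6, sub_self]; exact (qPlace K hq hq9).asIdeal.zero_mem)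

include hζ in
/-- `ψ` of an associate of `s` equals `ψ(s)`. [folklore] -/
theorem psi_eq_of_associated (hq : q.Prime) (hq9 : q % 9 = 8) {s t : 𝓞 K} (hs : s ≠ 0)
    (h : Associated s t) : psi ζ q hq hq9 t = psi ζ q hq hq9 s := by
  obtain ⟨u, rfl⟩ := h
  rw [psi_mul hζ hq hq9 hs u.ne_zero, psi_unit hζ hq hq9, add_zero]

end Psi


/-! ## The `q`-adic cube criterion ([VI] p. 67, replacing the product formula for `(·, q)_𝔭`) -/

section CubeCriterion

variable [IsCyclotomicExtension {3} ℚ K] {ζ : 𝓞 K} (hζ : IsPrimitiveRoot ζ 3) {q : ℕ}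

omit [NumberField K] [IsCyclotomicExtension {3} ℚ K] in
/-- A prime element of `𝓞 K` dividing a natural number `N ≠ 0` divides one of its prime factors.
[folklore] -/
theorem exists_prime_dvd_of_prime_dvd_natCast {π : 𝓞 K} (hπ : Prime π) {N : ℕ} (hN : N ≠ 0)
    (h : π ∣ (N : 𝓞 K)) : ∃ p : ℕ, p.Prime ∧ p ∣ N ∧ π ∣ (p : 𝓞 K) := by
  induction N using Nat.strong_induction_on with
  | _ N ih =>
    rcases Nat.lt_or_ge N 2 with hlt | hge
    · interval_cases N
      · exact absurd rfl hN
      · exact absurd (isUnit_of_dvd_one (by simpa using h)) hπ.not_unit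
    · have hp : N.minFac.Prime := Nat.minFac_prime (by omega)
      have hdvd : N.minFac ∣ N := Nat.minFac_dvd N
      obtain ⟨M, hM⟩ := hdvd
      have hM0 : M ≠ 0 := by rintro rfl; rw [mul_zero] at hM; exact hN hM
      have hcast : (N : 𝓞 K) = (N.minFac : 𝓞 K) * (M : 𝓞 K) := by
        rw [← Nat.cast_mul, ← hM]
      rw [hcast] at h
      rcases hπ.dvd_or_dvd h with h1 | h1
      · exact ⟨N.minFac, hp, ⟨M, hM⟩, h1⟩
      · have hMlt : M < N := by
          have := hp.two_le
          rcases Nat.eq_zero_or_pos M with h0 | h0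
          · exact absurd h0 hM0
          · calc M = 1 * M := (one_mul M).symm
              _ < N.minFac * M := Nat.mul_lt_mul_of_pos_right (by omega) h0
              _ = N := hM.symm
        obtain ⟨p, hp', hpM, hπp⟩ := ih M hMlt hM0 h1
        exact ⟨p, hp', hpM.trans ⟨N.minFac, hM.trans (mul_comm _ _)⟩, hπp⟩

/-- `λ = ζ − 1` is a prime of `𝓞 K` (Mathlib `zeta_sub_one_prime'`), and `3 = −λ²ζ²`.
[cite: IrelandRosen1982, Ch. 9 §1 Prop. 9.1.4 (a)] -/
theorem prime_zeta_sub_one (hζ : IsPrimitiveRoot ζ 3) :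
    Prime (ζ - 1) ∧ (3 : 𝓞 K) = -(ζ - 1) ^ 2 * ζ ^ 2 := by
  have hζK : IsPrimitiveRoot ((ζ : 𝓞 K) : K) 3 := hζ.map_of_injective RingOfIntegers.coe_injective
  have hto : hζK.toInteger = ζ := Subtype.ext rfl
  haveI : Fact (Nat.Prime 3) := ⟨Nat.prime_three⟩
  refine ⟨by simpa only [hto] using hζK.zeta_sub_one_prime', ?_⟩
  have hz : ζ ^ 2 + ζ + 1 = 0 := sq_add_self_add_one_eq_zero hζ
  linear_combination (ζ ^ 2 - 3 * ζ + 3) * hz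

include hζ in
/-- **`ψ(π) = 0` for the primes `π ∣ 3N`** when every prime factor of `N` is `≡ 2 (mod 3)` (so is
inert: `π ~ p` rational, or `π ~ λ`). [folklore] -/
theorem psi_eq_zero_of_prime_dvd (hq : q.Prime) (hq9 : q % 9 = 8) {N : ℕ} (hN : N ≠ 0)
    (hN3 : ∀ p : ℕ, p.Prime → p ∣ N → p % 3 = 2) {π : 𝓞 K} (hπ : Prime π)
    (h : π ∣ (3 * N : 𝓞 K)) : psi ζ q hq hq9 π = 0 := by
  have h' : π ∣ ((3 * N : ℕ) : 𝓞 K) := by push_cast; exact h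
  obtain ⟨p, hp, hpN, hπp⟩ := exists_prime_dvd_of_prime_dvd_natCast hπ (by omega) h'
  rcases (Nat.Prime.dvd_mul hp).mp hpN with hp3 | hpN'
  · -- `p = 3`: `π ∣ 3 = -λ²ζ²`, so `π ~ λ`
    have hp3' : p = 3 := (Nat.prime_dvd_prime_iff_eq hp Nat.prime_three).mp hp3
    subst hp3'
    obtain ⟨hlam, h3⟩ := prime_zeta_sub_one hζ
    have : π ∣ (ζ - 1) ^ 2 * ζ ^ 2 := by
      have h3' : ((3 : ℕ) : 𝓞 K) = -((ζ - 1) ^ 2 * ζ ^ 2) := by push_cast; rw [h3]; ring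
      rw [h3', dvd_neg] at hπp; exact hπp
    rcases hπ.dvd_or_dvd this with h1 | h1
    · have h2 : π ∣ ζ - 1 := hπ.dvd_of_dvd_pow h1
      have hass : Associated π (ζ - 1) := hπ.associated_of_dvd hlam h2
      rw [psi_eq_of_associated hζ hq hq9 hlam.ne_zero hass.symm]
      exact psi_lambda hζ hq hq9
    · exact absurd (isUnit_of_dvd_unit (hπ.dvd_of_dvd_pow h1) (hζ.isUnit (by norm_num))) hπ.not_unit
  · -- `p ∣ N`, `p ≡ 2 (mod 3)` inert: `π ~ p`
    have hp2 : p % 3 = 2 := hN3 p hp hpN'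
    have hpK : Prime (p : 𝓞 K) := prime_natCast hp hp2
    have hass : Associated π (p : 𝓞 K) := hπ.associated_of_dvd hpK hπp
    rw [psi_eq_of_associated hζ hq hq9 hpK.ne_zero hass.symm]
    by_cases hpq : p = q
    · subst hpq; exact psi_q hζ hq hq9
    · exact psi_natCast hζ hq hq9 (fun hd => hpq ((Nat.prime_dvd_prime_iff_eq hq hp).mp hd).symm)

/-- The height-one prime `(π)` of a prime element. [folklore] -/
def primePlace {π : 𝓞 K} (hπ : Prime π) : HeightOneSpectrum (𝓞 K) :=
  ⟨span {π}, (Ideal.span_singleton_prime hπ.ne_zero).mpr hπ, by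
    rw [Ne, Ideal.span_singleton_eq_bot]; exact hπ.ne_zero⟩

omit [NumberField K] [IsCyclotomicExtension {3} ℚ K] in
/-- The ideal of `primePlace hπ` is `(π)`. [folklore] -/
@[simp] theorem primePlace_asIdeal {π : 𝓞 K} (hπ : Prime π) : (primePlace hπ).asIdeal = span {π} := rfl

omit [IsCyclotomicExtension {3} ℚ K] in
/-- `k ≤ multiplicity (π) (s) → πᵏ ∣ s` (principal prime). [folklore] -/
theorem pow_dvd_of_le_multiplicity_span {π s : 𝓞 K} (hπ : Prime π) {k : ℕ}
    (hk : k ≤ multiplicity (primePlace hπ).asIdeal (span {s})) : π ^ k ∣ s := by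
  have := pow_dvd_of_le_multiplicity hk
  rwa [primePlace_asIdeal, Ideal.span_singleton_pow, Ideal.dvd_span_singleton, Ideal.mem_span_singleton]
    at this

omit [NumberField K] [IsCyclotomicExtension {3} ℚ K] in
/-- `(s) ≠ 0` in the monoid of ideals, for `s ≠ 0`. [folklore] -/
theorem span_singleton_ne_zero' {s : 𝓞 K} (hs : s ≠ 0) : (span {s} : Ideal (𝓞 K)) ≠ 0 := by
  rw [Ne, Ideal.zero_eq_bot, Ideal.span_singleton_eq_bot]; exact hs

omit [IsCyclotomicExtension {3} ℚ K] in
/-- Additivity of `multiplicity 𝔭 (·)` on principal ideals. [folklore] -/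
theorem multiplicity_span_mul (𝔭 : HeightOneSpectrum (𝓞 K)) {s t : 𝓞 K} (hs : s ≠ 0) (ht : t ≠ 0) :
    multiplicity 𝔭.asIdeal (span {s * t}) =
      multiplicity 𝔭.asIdeal (span {s}) + multiplicity 𝔭.asIdeal (span {t}) := by
  rw [← Ideal.span_singleton_mul_span_singleton]
  refine multiplicity_mul 𝔭.prime (FiniteMultiplicity.of_prime_left 𝔭.prime ?_)
  rw [Ideal.span_singleton_mul_span_singleton]
  exact span_singleton_ne_zero' (mul_ne_zero hs ht)

omit [IsCyclotomicExtension {3} ℚ K] in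
/-- `multiplicity 𝔭 (sᵏ) = k · multiplicity 𝔭 (s)`. [folklore] -/
theorem multiplicity_span_pow (𝔭 : HeightOneSpectrum (𝓞 K)) {s : 𝓞 K} (hs : s ≠ 0) (k : ℕ) :
    multiplicity 𝔭.asIdeal (span {s ^ k}) = k * multiplicity 𝔭.asIdeal (span {s}) := by
  rw [← Ideal.span_singleton_pow]
  exact (FiniteMultiplicity.of_prime_left 𝔭.prime (span_singleton_ne_zero' hs)).multiplicity_pow 𝔭.prime

omit [IsCyclotomicExtension {3} ℚ K] in
/-- `multiplicity 𝔭 (s) = 0` when `s ∉ 𝔭`. [folklore] -/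
theorem multiplicity_span_eq_zero (𝔭 : HeightOneSpectrum (𝓞 K)) {s : 𝓞 K} (hs : s ∉ 𝔭.asIdeal) :
    multiplicity 𝔭.asIdeal (span {s}) = 0 := by
  rw [multiplicity_eq_zero, Ideal.dvd_span_singleton]
  exact hs

omit [IsCyclotomicExtension {3} ℚ K] in
/-- `multiplicity (π) (π) = 1`. [folklore] -/
theorem multiplicity_span_self {π : 𝓞 K} (hπ : Prime π) :
    multiplicity (primePlace hπ).asIdeal (span {π}) = 1 :=
  multiplicity_self

include hζ in
/-- **The `q`-adic cube criterion** (Cassels [VI] p. 67: with (10) "`lβ^{D−D²}` an ideal cube"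
and the symbols of (11)). Let every prime factor of `N ≠ 0` be `≡ 2 (mod 3)`. If `s ∈ 𝓞 K ∖ 0`
satisfies `3 ∣ ord_𝔭(s)` for every prime `𝔭` of `𝓞 K` with `3N ∉ 𝔭`, then `ψ(s) = 0` — since
`𝓞 K = ℤ[ρ]` is a PID (`three_pid`), `s` is a unit times a cube times a product of primes dividing
`3N`, all of which `ψ` kills (`q ≡ 8 (mod 9)`). [cite: Cassels1964ArithmeticVI, p. 67 (10)–(11)] -/
theorem psi_eq_zero_of_dvd_multiplicity (hq : q.Prime) (hq9 : q % 9 = 8) {N : ℕ} (hN : N ≠ 0)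
    (hN3 : ∀ p : ℕ, p.Prime → p ∣ N → p % 3 = 2) {s : 𝓞 K} (hs : s ≠ 0)
    (hmul : ∀ 𝔭 : HeightOneSpectrum (𝓞 K), (3 * N : 𝓞 K) ∉ 𝔭.asIdeal →
      3 ∣ multiplicity 𝔭.asIdeal (span {s})) :
    psi ζ q hq hq9 s = 0 := by
  haveI := IsCyclotomicExtension.Rat.three_pid K
  -- strong induction on the norm of `(s)`
  suffices H : ∀ n : ℕ, ∀ {s : 𝓞 K}, absNorm (span {s}) = n → s ≠ 0 →
      (∀ 𝔭 : HeightOneSpectrum (𝓞 K), (3 * N : 𝓞 K) ∉ 𝔭.asIdeal →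
        3 ∣ multiplicity 𝔭.asIdeal (span {s})) → psi ζ q hq hq9 s = 0 from
    H _ rfl hs hmul
  intro n
  induction n using Nat.strong_induction_on with
  | _ n ih =>
    intro s hn hs hmul
    by_cases hu : IsUnit s
    · obtain ⟨u, rfl⟩ := hu
      exact psi_unit hζ hq hq9 u
    obtain ⟨π, hπirr, hπs⟩ := WfDvdMonoid.exists_irreducible_factor hu hs
    have hπ : Prime π := hπirr.prime
    obtain ⟨s₁, rfl⟩ := hπs
    have hs₁ : s₁ ≠ 0 := right_ne_zero_of_mul hs
    -- norms drop when a positive power of `π` is removed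
    have hlt : ∀ {t : 𝓞 K}, t ≠ 0 → (∃ k, 0 < k ∧ π ^ k * t = π * s₁) → absNorm (span {t}) < n := by
      rintro t ht ⟨k, hk, he⟩
      rw [← hn, ← he, ← Ideal.span_singleton_mul_span_singleton, map_mul, ← Ideal.span_singleton_pow,
        map_pow]
      have h1 : 1 < absNorm (span {π}) := by
        have hne : absNorm (span {π}) ≠ 0 := by
          rw [Ne, absNorm_eq_zero_iff, Ideal.span_singleton_eq_bot]; exact hπ.ne_zero
        have hne1 : absNorm (span {π}) ≠ 1 := by
          rw [Ne, absNorm_eq_one_iff, Ideal.span_singleton_eq_top]; exact hπ.not_unit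
        omega
      have hpos : 0 < absNorm (span {t}) := by
        rw [pos_iff_ne_zero, Ne, absNorm_eq_zero_iff, Ideal.span_singleton_eq_bot]; exact ht
      calc absNorm (span {t}) = 1 * absNorm (span {t}) := (one_mul _).symm
        _ < absNorm (span {π}) ^ k * absNorm (span {t}) :=
          Nat.mul_lt_mul_of_pos_right (Nat.one_lt_pow hk.ne' h1) hpos
    by_cases hdiv : π ∣ (3 * N : 𝓞 K)
    · -- Case A: `π ∣ 3N`: strip one factor `π`
      have hmul₁ : ∀ 𝔭 : HeightOneSpectrum (𝓞 K), (3 * N : 𝓞 K) ∉ 𝔭.asIdeal →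
          3 ∣ multiplicity 𝔭.asIdeal (span {s₁}) := by
        intro 𝔭 h𝔭
        have h := hmul 𝔭 h𝔭
        have hπ𝔭 : π ∉ 𝔭.asIdeal := fun hmem => h𝔭 (by
          obtain ⟨t, ht⟩ := hdiv
          rw [ht]; exact 𝔭.asIdeal.mul_mem_right t hmem)
        rwa [multiplicity_span_mul 𝔭 hπ.ne_zero hs₁, multiplicity_span_eq_zero 𝔭 hπ𝔭, zero_add] at h
      rw [psi_mul hζ hq hq9 hπ.ne_zero hs₁, psi_eq_zero_of_prime_dvd hζ hq hq9 hN hN3 hπ hdiv,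
        ih _ (hlt hs₁ ⟨1, one_pos, by rw [pow_one]⟩) rfl hs₁ hmul₁, add_zero]
    · -- Case B: `π ∤ 3N`: then `π³ ∣ s`
      have h3 : 3 ∣ multiplicity (primePlace hπ).asIdeal (span {π * s₁}) :=
        hmul (primePlace hπ) (fun hmem => hdiv (Ideal.mem_span_singleton.mp hmem))
      have hge : 1 ≤ multiplicity (primePlace hπ).asIdeal (span {π * s₁}) := by
        rw [multiplicity_span_mul _ hπ.ne_zero hs₁, multiplicity_span_self hπ]; omega
      have hge3 : 3 ≤ multiplicity (primePlace hπ).asIdeal (span {π * s₁}) := by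
        obtain ⟨k, hk⟩ := h3; omega
      obtain ⟨s₃, hs₃⟩ := pow_dvd_of_le_multiplicity_span hπ hge3
      have hs₃0 : s₃ ≠ 0 := by rintro rfl; rw [mul_zero] at hs₃; exact hs hs₃
      have hmul₃ : ∀ 𝔭 : HeightOneSpectrum (𝓞 K), (3 * N : 𝓞 K) ∉ 𝔭.asIdeal →
          3 ∣ multiplicity 𝔭.asIdeal (span {s₃}) := by
        intro 𝔭 h𝔭
        have h := hmul 𝔭 h𝔭
        rw [hs₃, multiplicity_span_mul 𝔭 (pow_ne_zero 3 hπ.ne_zero) hs₃0,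
          multiplicity_span_pow 𝔭 hπ.ne_zero] at h
        exact (Nat.dvd_add_right (dvd_mul_right 3 _)).mp h
      rw [hs₃, psi_mul hζ hq hq9 (pow_ne_zero 3 hπ.ne_zero) hs₃0, psi_pow_three hζ hq hq9 hπ.ne_zero,
        zero_add]
      exact ih _ (hlt hs₃0 ⟨3, by norm_num, hs₃.symm⟩) rfl hs₃0 hmul₃

end CubeCriterion


/-! ## Cassels' local analysis at `q ‖ d` of a point of `x³ + y³ + dz³ = 0` -/

section PointAtQ

variable [IsCyclotomicExtension {3} ℚ K] {ζ : 𝓞 K} (hζ : IsPrimitiveRoot ζ 3) {q : ℕ}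

omit [NumberField K] [IsCyclotomicExtension {3} ℚ K] in
/-- In `πⁱA + πʲB + πᵏC = 0` with `π ∤ A` the exponent `i` is not strictly the smallest.
[cite: Cassels1959ArithmeticI, §7 Lemma 6 (proof, p. 69: "the 𝔭-adic values of two of the three terms must be equal")] -/
theorem not_lt_lt_of_sum_eq_zero {π : 𝓞 K} (hπ : Prime π) {A B C : 𝓞 K} (hA : ¬ π ∣ A)
    {i j k : ℕ} (h : π ^ i * A + π ^ j * B + π ^ k * C = 0) (hij : i < j) (hik : i < k) : False := by
  obtain ⟨j', rfl⟩ := Nat.exists_eq_add_of_lt hij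
  obtain ⟨k', rfl⟩ := Nat.exists_eq_add_of_lt hik
  have h' : π ^ i * (A + π * (π ^ j' * B + π ^ k' * C)) = 0 := by rw [← h]; ring
  rcases mul_eq_zero.mp h' with h0 | h0
  · exact pow_ne_zero i hπ.ne_zero h0
  · exact hA ⟨-(π ^ j' * B + π ^ k' * C), by linear_combination h0⟩

/-- `ψ(s) = ψ(t)` when `s ≡ t (mod q)` and `q ∤ s`. [folklore] -/
theorem psi_congr (hq : q.Prime) (hq9 : q % 9 = 8) {s t : 𝓞 K} (hs : ¬ (q : 𝓞 K) ∣ s)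
    (h : s - t ∈ (qPlace K hq hq9).asIdeal) : psi ζ q hq hq9 s = psi ζ q hq hq9 t := by
  have ht : ¬ (q : 𝓞 K) ∣ t := fun ht => hs (by
    have := (qPlace K hq hq9).asIdeal.add_mem h ((mem_inertPlace_iff hq _).mpr ht)
    rw [sub_add_cancel] at this
    exact (mem_inertPlace_iff hq _).mp this)
  rw [psi_of_not_dvd hq hq9 hs, psi_of_not_dvd hq hq9 ht, (Ideal.Quotient.eq).mpr h]

include hζ in
/-- `q ∤ τ = ζ − ζ²` and `q ∤ λ = ζ − 1` (both divide `3`). [folklore] -/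
theorem not_dvd_tau_and_not_dvd_lambda (hq : q.Prime) (hq9 : q % 9 = 8) :
    ¬ (q : 𝓞 K) ∣ ζ - ζ ^ 2 ∧ ¬ (q : 𝓞 K) ∣ ζ - 1 := by
  have hz : ζ ^ 2 + ζ + 1 = 0 := sq_add_self_add_one_eq_zero hζ
  have h3 := three_not_mem hq hq9 (K := K)
  rw [mem_inertPlace_iff] at h3
  constructor
  · intro h
    apply h3
    have : (3 : 𝓞 K) = -((ζ - ζ ^ 2) * (ζ - ζ ^ 2)) := by linear_combination (ζ ^ 2 - 3 * ζ + 3) * hz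
    rw [this, dvd_neg]; exact dvd_mul_of_dvd_left h _
  · intro h
    apply h3
    have : (3 : 𝓞 K) = -((ζ - 1) * ((ζ - 1) * ζ ^ 2)) := by linear_combination (ζ ^ 2 - 3 * ζ + 3) * hz
    rw [this, dvd_neg]; exact dvd_mul_of_dvd_left h _

include hζ in
/-- **Cassels' local analysis at a prime `q ‖ d`** ([VI] pp. 66–67, via [I] §4 (4), Lemma 0 and §7
Lemma 6–7 at `𝔭 = (q)`): let `(x, y, z) ∈ (𝓞 K)³`, `xyz ≠ 0`, `x³ + y³ + dz³ = 0` with `ord_q d = 1`,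
and suppose `ord_q(u) ≡ ord_q(v) (mod 3)` for `u = ρx + ρ²y`, `v = ρ²x + ρy` (i.e. `m(𝔵) = u/v` has
`q`-order `≡ 0 (mod 3)`). Then `ψ(x) + ψ(u) + ψ(v) = 0`. Indeed `ord_q x = ord_q y =: a` and with
`x = qᵃx₁`, `y = qᵃy₁`: exactly one of `x₁ + y₁, u₁, v₁` is divisible by `q` (their product is
`x₁³ + y₁³ = −q^w d₁z₁³`, `w ≡ 1 (mod 3)`), and the hypothesis rules out `u₁, v₁`; so `y₁ ≡ −x₁`,
`u₁ ≡ τx₁`, `v₁ ≡ −τx₁ (mod q)` and `ψ(x) + ψ(u) + ψ(v) = 3ψ(x₁) = 0`.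
[cite: Cassels1964ArithmeticVI, pp. 66–67] [cite: Cassels1959ArithmeticI, §7 Lemma 6 (i), Lemma 7] -/
theorem psi_x_add_psi_u_add_psi_v (hq : q.Prime) (hq9 : q % 9 = 8) {x y z d : 𝓞 K} (hx : x ≠ 0)
    (hy : y ≠ 0) (hz : z ≠ 0) (hd0 : d ≠ 0) (hd : multiplicity (q : 𝓞 K) d = 1)
    (hC : x ^ 3 + y ^ 3 + d * z ^ 3 = 0)
    (hm : (multiplicity (q : 𝓞 K) (ζ * x + ζ ^ 2 * y) : ZMod 3) =
      multiplicity (q : 𝓞 K) (ζ ^ 2 * x + ζ * y)) :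
    psi ζ q hq hq9 x + psi ζ q hq hq9 (ζ * x + ζ ^ 2 * y) + psi ζ q hq hq9 (ζ ^ 2 * x + ζ * y) = 0 := by
  have hz2 : ζ ^ 2 + ζ + 1 = 0 := sq_add_self_add_one_eq_zero hζ
  set Q : 𝓞 K := (q : 𝓞 K) with hQdef
  have hQ : Prime Q := prime_q hq hq9
  obtain ⟨hτ, hlam⟩ := not_dvd_tau_and_not_dvd_lambda hζ hq hq9 (K := K)
  -- the unit parts
  set a := multiplicity Q x
  set b := multiplicity Q y
  set c := multiplicity Q z
  set x₁ := unitPart Q x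
  set y₁ := unitPart Q y
  set z₁ := unitPart Q z
  set d₁ := unitPart Q d
  have ex : Q ^ a * x₁ = x := pow_mul_unitPart x
  have ey : Q ^ b * y₁ = y := pow_mul_unitPart y
  have ez : Q ^ c * z₁ = z := pow_mul_unitPart z
  have ed : Q * d₁ = d := by have := pow_mul_unitPart (π := Q) d; rwa [hd, pow_one] at this
  have hx₁ : ¬ Q ∣ x₁ := not_dvd_unitPart hQ hx
  have hy₁ : ¬ Q ∣ y₁ := not_dvd_unitPart hQ hy
  have hz₁ : ¬ Q ∣ z₁ := not_dvd_unitPart hQ hz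
  have hd₁ : ¬ Q ∣ d₁ := not_dvd_unitPart hQ hd0
  have hx₁0 : x₁ ≠ 0 := unitPart_ne_zero hQ hx
  have hy₁0 : y₁ ≠ 0 := unitPart_ne_zero hQ hy
  have hz₁0 : z₁ ≠ 0 := unitPart_ne_zero hQ hz
  have hd₁0 : d₁ ≠ 0 := unitPart_ne_zero hQ hd0
  have hdz : ¬ Q ∣ d₁ * z₁ ^ 3 := fun h => by
    rcases hQ.dvd_or_dvd h with h | h
    · exact hd₁ h
    · exact hz₁ (hQ.dvd_of_dvd_pow h)
  -- the equation in terms of unit parts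
  have hE : Q ^ (3 * a) * x₁ ^ 3 + Q ^ (3 * b) * y₁ ^ 3 + Q ^ (3 * c + 1) * (d₁ * z₁ ^ 3) = 0 := by
    rw [← ex, ← ey, ← ez, ← ed] at hC
    linear_combination hC
  have hE2 : Q ^ (3 * b) * y₁ ^ 3 + Q ^ (3 * a) * x₁ ^ 3 + Q ^ (3 * c + 1) * (d₁ * z₁ ^ 3) = 0 := by
    linear_combination hE
  have hE3 : Q ^ (3 * c + 1) * (d₁ * z₁ ^ 3) + Q ^ (3 * a) * x₁ ^ 3 + Q ^ (3 * b) * y₁ ^ 3 = 0 := by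
    linear_combination hE
  -- `a = b` and `3a < 3c + 1`
  have hx3 : ¬ Q ∣ x₁ ^ 3 := fun h => hx₁ (hQ.dvd_of_dvd_pow h)
  have hy3 : ¬ Q ∣ y₁ ^ 3 := fun h => hy₁ (hQ.dvd_of_dvd_pow h)
  have hab : a = b ∧ 3 * a < 3 * c + 1 := by
    rcases lt_trichotomy a b with h | h | h
    · exfalso
      rcases lt_or_gt_of_ne (show 3 * a ≠ 3 * c + 1 by omega) with h' | h'
      · exact not_lt_lt_of_sum_eq_zero hQ hx3 hE (by omega) h'
      · exact not_lt_lt_of_sum_eq_zero hQ hdz hE3 h' (by omega)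
    · refine ⟨h, ?_⟩
      rcases lt_or_gt_of_ne (show 3 * a ≠ 3 * c + 1 by omega) with h' | h'
      · exact h'
      · exact (not_lt_lt_of_sum_eq_zero hQ hdz hE3 h' (by omega)).elim
    · exfalso
      rcases lt_or_gt_of_ne (show 3 * b ≠ 3 * c + 1 by omega) with h' | h'
      · exact not_lt_lt_of_sum_eq_zero hQ hy3 hE2 (by omega) h'
      · exact not_lt_lt_of_sum_eq_zero hQ hdz hE3 (by omega) h'
  obtain ⟨hab, hlt⟩ := hab
  obtain ⟨w', hw'⟩ := Nat.exists_eq_add_of_lt hlt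
  -- `x₁³ + y₁³ = Q^w (-d₁ z₁³)` with `w = w' + 1 ≡ 1 (mod 3)`
  set w := w' + 1 with hw
  have hw3 : (w : ZMod 3) = 1 := by
    have : w % 3 = 1 := by omega
    rw [← ZMod.natCast_mod, this]; rfl
  have hw0 : w ≠ 0 := by omega
  have hE' : x₁ ^ 3 + y₁ ^ 3 = Q ^ w * (-(d₁ * z₁ ^ 3)) := by
    have h1 : Q ^ (3 * a) * (x₁ ^ 3 + y₁ ^ 3 - Q ^ w * (-(d₁ * z₁ ^ 3))) = 0 := by
      rw [← hE, ← hab, hw', hw]; ring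
    rcases mul_eq_zero.mp h1 with h0 | h0
    · exact absurd h0 (pow_ne_zero _ hQ.ne_zero)
    · linear_combination h0
  have hdz' : ¬ Q ∣ -(d₁ * z₁ ^ 3) := fun h => hdz (dvd_neg.mp h)
  -- `u = Q^a u₁`, `v = Q^a v₁`
  set u₁ := ζ * x₁ + ζ ^ 2 * y₁ with hu₁
  set v₁ := ζ ^ 2 * x₁ + ζ * y₁ with hv₁
  have eu : ζ * x + ζ ^ 2 * y = Q ^ a * u₁ := by rw [← ex, ← ey, ← hab]; ring
  have ev : ζ ^ 2 * x + ζ * y = Q ^ a * v₁ := by rw [← ex, ← ey, ← hab]; ring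
  have hprod : (x₁ + y₁) * u₁ * v₁ = Q ^ w * (-(d₁ * z₁ ^ 3)) := by
    rw [← hE']
    linear_combination ((-1) * y₁ ^ 3 + (-1) * x₁ ^ 3 + ζ * y₁ ^ 3 + ζ * x₁ ^ 3 + ζ ^ 2 * x₁ * y₁ ^ 2 +
      ζ ^ 2 * x₁ ^ 2 * y₁) * hz2
  have hrhs0 : Q ^ w * (-(d₁ * z₁ ^ 3)) ≠ 0 :=
    mul_ne_zero (pow_ne_zero _ hQ.ne_zero) (neg_ne_zero.mpr (mul_ne_zero hd₁0 (pow_ne_zero 3 hz₁0)))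
  have hu₁0 : u₁ ≠ 0 := by
    intro h; rw [h, mul_zero, zero_mul] at hprod; exact hrhs0 hprod.symm
  have hv₁0 : v₁ ≠ 0 := by
    intro h; rw [h, mul_zero] at hprod; exact hrhs0 hprod.symm
  have hxy0 : x₁ + y₁ ≠ 0 := by
    intro h; rw [h, zero_mul, zero_mul] at hprod; exact hrhs0 hprod.symm
  -- at most one of the three factors is divisible by `Q`
  have e1 : (ζ - 1) * x₁ = u₁ - ζ * v₁ := by
    rw [hu₁, hv₁]; linear_combination ((-1) * x₁ + ζ * x₁) * hz2
  have e2 : u₁ - (ζ - ζ ^ 2) * x₁ = ζ ^ 2 * (x₁ + y₁) := by rw [hu₁]; ring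
  have e3 : v₁ - -((ζ - ζ ^ 2) * x₁) = ζ * (x₁ + y₁) := by rw [hv₁]; ring
  have hex1 : Q ∣ u₁ → Q ∣ v₁ → False := fun h1 h2 => by
    have : Q ∣ (ζ - 1) * x₁ := by rw [e1]; exact dvd_sub h1 (dvd_mul_of_dvd_right h2 ζ)
    rcases hQ.dvd_or_dvd this with h | h
    · exact hlam h
    · exact hx₁ h
  have hex2 : Q ∣ u₁ → Q ∣ x₁ + y₁ → False := fun h1 h2 => by
    have : Q ∣ (ζ - ζ ^ 2) * x₁ := by
      have h := dvd_sub h1 (dvd_mul_of_dvd_right h2 (ζ ^ 2))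
      rwa [← e2, sub_sub_cancel] at h
    rcases hQ.dvd_or_dvd this with h | h
    · exact hτ h
    · exact hx₁ h
  have hex3 : Q ∣ v₁ → Q ∣ x₁ + y₁ → False := fun h1 h2 => by
    have : Q ∣ (ζ - ζ ^ 2) * x₁ := by
      have h := dvd_sub h1 (dvd_mul_of_dvd_right h2 ζ)
      rw [← e3, sub_sub_cancel, dvd_neg] at h; exact h
    rcases hQ.dvd_or_dvd this with h | h
    · exact hτ h
    · exact hx₁ h
  -- multiplicities: `ord(x₁ + y₁) + ord u₁ + ord v₁ = w`, `ord u₁ ≡ ord v₁ (mod 3)`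
  have hmult : multiplicity Q (x₁ + y₁) + multiplicity Q u₁ + multiplicity Q v₁ = w := by
    have h0 := (unitPart_eq_of_eq_pow_mul hQ (mul_ne_zero (mul_ne_zero hxy0 hu₁0) hv₁0) hprod hdz').1
    rw [(unitPart_mul hQ (mul_ne_zero hxy0 hu₁0) hv₁0).1, (unitPart_mul hQ hxy0 hu₁0).1] at h0
    exact h0
  have hm' : (multiplicity Q u₁ : ZMod 3) = multiplicity Q v₁ := by
    have hQa : multiplicity Q (Q ^ a) = a := by
      rw [(unitPart_pow hQ hQ.ne_zero a).1, (unitPart_self hQ).1, mul_one]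
    rw [eu, ev, (unitPart_mul hQ (pow_ne_zero a hQ.ne_zero) hu₁0).1,
      (unitPart_mul hQ (pow_ne_zero a hQ.ne_zero) hv₁0).1, hQa] at hm
    push_cast at hm
    exact add_left_cancel hm
  have hQprod : Q ∣ (x₁ + y₁) * u₁ * v₁ := by
    rw [hprod]; exact dvd_mul_of_dvd_left (dvd_pow_self Q hw0) _
  -- the two excluded cases contradict `hm'`
  have hxy : Q ∣ x₁ + y₁ := by
    rcases hQ.dvd_or_dvd hQprod with h | h
    · rcases hQ.dvd_or_dvd h with h | h
      · exact h
      · exfalso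
        have hv : multiplicity Q v₁ = 0 := multiplicity_eq_zero.mpr (fun h' => hex1 h h')
        have hs : multiplicity Q (x₁ + y₁) = 0 := multiplicity_eq_zero.mpr (fun h' => hex2 h h')
        rw [hv, hs, zero_add, add_zero] at hmult
        rw [hv, hmult, hw3, Nat.cast_zero] at hm'
        exact one_ne_zero hm'
    · exfalso
      have hu : multiplicity Q u₁ = 0 := multiplicity_eq_zero.mpr (fun h' => hex1 h' h)
      have hs : multiplicity Q (x₁ + y₁) = 0 := multiplicity_eq_zero.mpr (fun h' => hex3 h h')
      rw [hu, hs, zero_add, zero_add] at hmult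
      rw [hu, hmult, hw3, Nat.cast_zero] at hm'
      exact zero_ne_one hm'
  have hu : ¬ Q ∣ u₁ := fun h => hex2 h hxy
  have hv : ¬ Q ∣ v₁ := fun h => hex3 h hxy
  have hτ0 : ζ - ζ ^ 2 ≠ 0 := fun h => hτ (by rw [h]; exact dvd_zero Q)
  have hτx : (ζ - ζ ^ 2) * x₁ ≠ 0 := mul_ne_zero hτ0 hx₁0
  -- `ψ(u) = ψ(τ x₁) = ψ(x₁)`, `ψ(v) = ψ(-τ x₁) = ψ(x₁)`
  have hψu : psi ζ q hq hq9 (ζ * x + ζ ^ 2 * y) = psi ζ q hq hq9 x₁ := by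
    rw [eu, psi_q_pow_mul hζ hq hq9 hu₁0, psi_congr hq hq9 hu (t := (ζ - ζ ^ 2) * x₁)
      (by rw [e2]; exact (mem_inertPlace_iff hq _).mpr (dvd_mul_of_dvd_right hxy _)),
      psi_mul hζ hq hq9 hτ0 hx₁0, psi_tau hζ hq hq9, zero_add]
  have hψv : psi ζ q hq hq9 (ζ ^ 2 * x + ζ * y) = psi ζ q hq hq9 x₁ := by
    rw [ev, psi_q_pow_mul hζ hq hq9 hv₁0, psi_congr hq hq9 hv (t := -((ζ - ζ ^ 2) * x₁))
      (by rw [e3]; exact (mem_inertPlace_iff hq _).mpr (dvd_mul_of_dvd_right hxy _)),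
      psi_neg hζ hq hq9 hτx, psi_mul hζ hq hq9 hτ0 hx₁0, psi_tau hζ hq hq9,
      zero_add]
  have hψx : psi ζ q hq hq9 x = psi ζ q hq hq9 x₁ := by rw [← ex, psi_q_pow_mul hζ hq hq9 hx₁0]
  rw [hψu, hψv, hψx]
  generalize psi ζ q hq hq9 x₁ = t
  have : t + t + t = 3 * t := by ring
  rw [this, show (3 : ZMod 3) = 0 from rfl, zero_mul]

end PointAtQ

end EisensteinCubic

end Literature.NumberTheory.GaloisRepresentations
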